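import Literature.Analysis.FluidPDE.BiotSavartSupInterpolation
import Literature.Analysis.FluidPDE.BiotSavartRepresentationSqIntegrable
import Summits.NavierStokesRegularity.NavierStokesRegularity.Theorems.CertifiedBlowupCertifiedBlowupVorticityRateBlowupConstantFloor
import Summits.NavierStokesRegularity.NavierStokesRegularity.Theorems.CertifiedBlowupCertifiedBlowupVorticityRateBlowupTypeIIGauge
import HarnessLib

/-!
# Certificate class `CertifiedBlowupVorticityRateBlowup` (stmt-NavierStokesRegularity-8639): THE CERTIFICATE CONSTANT PINS THE
# MODULATION LAW — enstrophy `≤ (T − t)^{−2C}`, velocity `≤ K(T − t)^{−(1+2C)/3}`, vertex distance `d ≤ K′(T − t)^{(1−4C)/3}`,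
# and `C > 1/4` strictly

Theorems file landed `--supports stmt-NavierStokesRegularity-8639` (cell `ns-blowup`, GROUP B zone Z1 → the certificate crux;
eighth crux-side deposit of the zone-Z1 seat; the corollary file of deposit 6 `…ConstantFloor`, split off by the 400-line rule).
For a witness `(ν, T, u, p)` of the certificate class with `(T − t)‖curl u(t, x)‖ ≤ C` on `[t₀, T) × ℝ³`:

* `integral_sq_norm_curl_le_rpow` — THE POWER LAW FOR ALL TIMES: `∫|ω(t)|² ≤ ∫|ω(t₀)|² · ((T − t₀)/(T − t))^{2C}` for every
  `t ∈ [t₀, T)` (deposit 6's geometric bound with ratio `q = r^{1/n}`, `r = (T − t₀)/(T − t)`, hits `t` exactly at step `n`;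
  `n(r^{1/n} − 1) → log r` is the slope of `h ↦ rʰ` at `0`);
* `cube_norm_le_of_vorticityRate` — THE VELOCITY IS AT MOST `(T − t)^{−(1+2C)/3}`: for every `t ∈ [t₀, T)` and `x`,
  `(T − t)^{1+2C} ‖u(t, x)‖³ ≤ 8(4π)⁻¹ C (T − t₀)^{2C} ∫|ω(t₀)|²` — the slice is the Biot–Savart velocity of its vorticity
  (`biotSavart_curl_eq_self_of_lintegral_sq_lt_top`) and `‖K₃ ∗ ω‖_∞ ≤ 2(4π)^{−1/3}‖ω‖_∞^{1/3}‖ω‖₂^{2/3}`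
  (`norm_biotSavart_le_rpow_third`), cubed;
* `gauge_vertex_distance_cube_le` — THE MODULATION LAW IS PINNED: at any gauge time `tₖ ∈ [t₀, T)` with `λₖ > 0` and a point
  `xₖ` where `(λₖ/ν)‖u(tₖ, xₖ)‖ ≥ 1/2`, the dimensionless vertex distance `dₖ = ν(T − tₖ)/λₖ²` obeys
  `dₖ³ ≤ (64/ν³)(8(4π)⁻¹C(T − t₀)^{2C}∫|ω(t₀)|²)² · (T − tₖ)^{1−4C}`; so `dₖ ≲ (T − tₖ)^{(1−4C)/3}`;
* `vorticityRate_witness_const_gt_quarter` — **`C > 1/4` STRICTLY** for every witness: deposit 7's Type-II-modulated gauge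
  sequence (`dₖ → ∞`, forced by KNSS) is incompatible with `C = 1/4` (then `dₖ³ ≤ K` for all large `k`), and `C ≥ 1/4` is
  deposit 6; `vorticityRate_witness_velocity_exponent` — assembled: for every witness and admissible `C`, some `t₀ < T` and
  `K` with `(T − t)^{1+2C}‖u(t, x)‖³ ≤ K` on `[t₀, T) × ℝ³`.

ZONE-Z1 READING (TEMPLATE T1.2 modulation dictionary, quantified by the certificate constant): a certificate-class witness with
constant `C_ω` has velocity rate exponent `γ_u ≤ (1 + 2C_ω)/3` and gauge modulation `λ_a(t) = ν/‖u(t)‖_∞ ≳ (T − t)^{(1+2C_ω)/3}`,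
`d(t) ≲ (T − t)^{(1−4C_ω)/3}`; KNSS's `γ_u > 1/2` is `C_ω > 1/4` again. K-AUDIT HOOK: a candidate printing `‖u‖_∞ ∼ (T − t)^{−γ}`
needs `C_ω ≥ (3γ − 1)/2` — a Hou-type `γ = 1` needs `C_ω ≥ 1`; `γ = 2/3` needs `C_ω ≥ 1/2`. No new definitions, no named-fact
hypotheses, no `sorry`. WHAT THIS IS NOT: not a blow-up or regularity claim — a priori inequalities about a HYPOTHETICAL witness;
crux 8639, crux 8640 and (AX-L) untouched. Author: ns-blowup-profile-eng-1 g11, 2026-08-27.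

## References
* J. C. Robinson, J. L. Rodrigo, W. Sadowski, CUP 2016, Thm 12.3 (12.11)–(12.12). [RobinsonRodrigoSadowski2016]
* A. J. Majda, A. L. Bertozzi, *Vorticity and Incompressible Flow*, CUP 2002, §2.4.1 Prop. 2.16, §4.1.3 (4.30). [MajdaBertozziCUP2002]
* G. Koch, N. Nadirashvili, G. Seregin, V. Šverák, Acta Math. 203 (2009), Thms 6.1–6.2. [KochNadirashviliSereginSverak2009]
-/

-- the summit and its single problem share the name (D-0017 nested layout)
set_option linter.dupNamespace false

noncomputable section

open MeasureTheory Set Function Filter Topology Metric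
open scoped ENNReal NNReal

namespace Summit.NavierStokesRegularity.NavierStokesRegularity.Theorems.CertifiedBlowupVorticityRateBlowup.ConstantFloor

open Literature.Analysis.FluidPDE
open Summit.NavierStokesRegularity.NavierStokesRegularity.Theorems.CertifiedBlowupAxisymBlowup.CompactAmplification
open Summit.NavierStokesRegularity.NavierStokesRegularity.Theorems.CertifiedBlowupVorticityRateBlowup.InnerObject

variable {ν T : ℝ} {u : ℝ → EuclideanSpace ℝ (Fin 3) → EuclideanSpace ℝ (Fin 3)}
  {p : ℝ → EuclideanSpace ℝ (Fin 3) → ℝ}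

/-! ### The power law for all times -/

/-- `n (r^{1/n} − 1) → log r` (`r > 0`): the right slope of `h ↦ rʰ` at `h = 0` along `h = 1/n`. [folklore] -/
theorem tendsto_nat_mul_rpow_inv_sub_one {r : ℝ} (hr : 0 < r) :
    Tendsto (fun n : ℕ => (n : ℝ) * (r ^ (1 / (n : ℝ)) - 1)) atTop (𝓝 (Real.log r)) := by
  have hd : HasDerivAt (fun h : ℝ => r ^ h) (Real.log r) 0 := by
    have h := (Real.hasStrictDerivAt_const_rpow hr 0).hasDerivAt
    simpa using h
  have hslope := hd.tendsto_slope_zero_right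
  have hinv : Tendsto (fun n : ℕ => ((n : ℝ))⁻¹) atTop (𝓝[>] (0 : ℝ)) :=
    tendsto_inv_atTop_nhdsGT_zero.comp tendsto_natCast_atTop_atTop
  refine (hslope.comp hinv).congr' ?_
  filter_upwards [eventually_gt_atTop 0] with n hn
  simp only [Function.comp_apply, zero_add, Real.rpow_zero, smul_eq_mul, inv_inv, one_div]

/-- **The power law for all times.** For a classical unforced solution on `[0, T) × ℝ³`, `ν > 0`, in the Beale–Kato–Majda
class on every earlier slab, with `(T − t)‖curl u(t, x)‖ ≤ C` on `[t₀, T) × ℝ³` (`0 ≤ t₀ < T`): for every `t ∈ [t₀, T)`,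
`∫|curl u(t)|² ≤ (∫|curl u(t₀)|²) · ((T − t₀)/(T − t))^{2C}`. [cite: RobinsonRodrigoSadowski2016, Thm 12.3 (12.12)] -/
theorem integral_sq_norm_curl_le_rpow (hν : 0 < ν) (hcl : IsClassicalNSSolutionOn (Ico 0 T) ν 0 u p)
    (hreg : ∀ T'' < T, HasBoundedSobolevNormsOn (Icc 0 T'') u) {C t₀ : ℝ} (ht₀ : 0 ≤ t₀) (ht₀T : t₀ < T)
    (hω : ∀ t ∈ Ico t₀ T, ∀ x, (T - t) * ‖curl (u t) x‖ ≤ C) {t : ℝ} (ht : t ∈ Ico t₀ T) :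
    ∫ x, ‖curl (u t) x‖ ^ 2 ≤ (∫ x, ‖curl (u t₀) x‖ ^ 2) * ((T - t₀) / (T - t)) ^ (2 * C) := by
  set E₀ : ℝ := ∫ x, ‖curl (u t₀) x‖ ^ 2 with hE₀
  have hE₀0 : 0 ≤ E₀ := integral_nonneg fun x => sq_nonneg _
  rcases eq_or_lt_of_le ht.1 with heq | hlt
  · rw [← heq, div_self (sub_pos.2 ht₀T).ne', Real.one_rpow, mul_one]
  set r : ℝ := (T - t₀) / (T - t) with hr
  have hTt : 0 < T - t := sub_pos.2 ht.2
  have hr1 : 1 < r := by rw [hr, one_lt_div hTt]; linarith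
  have hr0 : 0 < r := by linarith
  -- for every `n ≥ 1`: `E(t) ≤ E₀ exp(2C n (r^{1/n} − 1))`
  have hbound : ∀ n : ℕ, 0 < n →
      ∫ x, ‖curl (u t) x‖ ^ 2 ≤ E₀ * Real.exp (2 * C * ((n : ℝ) * (r ^ (1 / (n : ℝ)) - 1))) := by
    intro n hn
    have hn0 : (0 : ℝ) < n := by exact_mod_cast hn
    set q : ℝ := r ^ (1 / (n : ℝ)) with hq
    have hq1 : 1 < q := Real.one_lt_rpow hr1 (by positivity)
    have hqn : q ^ n = r := by
      rw [hq, ← Real.rpow_natCast, ← Real.rpow_mul hr0.le, one_div_mul_cancel hn0.ne', Real.rpow_one]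
    have htn : T - (T - t₀) / q ^ n = t := by
      rw [hqn, hr, div_div_eq_mul_div, mul_div_cancel_left₀ (T - t) (sub_pos.2 ht₀T).ne']
      ring
    have h := integral_sq_norm_curl_geometric hν hcl hreg ht₀ ht₀T hω hq1 n
    rw [htn] at h
    refine h.trans (le_of_eq ?_)
    rw [hE₀, ← Real.exp_nat_mul]
    ring_nf
  -- the right-hand side tends to `E₀ r^{2C}`
  have hlim : Tendsto (fun n : ℕ => E₀ * Real.exp (2 * C * ((n : ℝ) * (r ^ (1 / (n : ℝ)) - 1)))) atTop
      (𝓝 (E₀ * Real.exp (2 * C * Real.log r))) :=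
    ((Real.continuous_exp.tendsto _).comp
      ((tendsto_nat_mul_rpow_inv_sub_one hr0).const_mul (2 * C))).const_mul E₀
  have hle : ∫ x, ‖curl (u t) x‖ ^ 2 ≤ E₀ * Real.exp (2 * C * Real.log r) :=
    ge_of_tendsto hlim ((eventually_gt_atTop 0).mono fun n hn => hbound n hn)
  rwa [show Real.exp (2 * C * Real.log r) = r ^ (2 * C) by rw [Real.rpow_def_of_pos hr0, mul_comm]] at hle

/-! ### The velocity bound -/

/-- **`(T − t)^{1+2C} ‖u(t, x)‖³ ≤ 8(4π)⁻¹ C (T − t₀)^{2C} ∫|ω(t₀)|²`** for a witness of the crux with the rate on `[t₀, T)`: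
the slice `u(t)` is the Biot–Savart velocity of its vorticity (finite energy, finite enstrophy), so
`‖u(t, x)‖ ≤ 2(4π)^{−1/3}‖ω(t)‖_∞^{1/3}(∫|ω(t)|²)^{1/3}`; cube, insert `‖ω(t)‖_∞ ≤ C/(T − t)` and the power law.
[cite: MajdaBertozziCUP2002, §2.4.1 Prop. 2.16 and §4.1.3 (4.30)] -/
theorem cube_norm_le_of_vorticityRate (hν : 0 < ν) (hT : 0 < T) (hmax : IsMaximalSmoothSolution ν 0 u p T)
    (hLH : IsLerayHopfOn T ν 0 (u 0) u) (hdec : HasRapidSpatialDecay (u 0))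
    {C t₀ : ℝ} (ht₀ : 0 ≤ t₀) (ht₀T : t₀ < T) (hω : ∀ t ∈ Ico t₀ T, ∀ x, (T - t) * ‖curl (u t) x‖ ≤ C)
    {t : ℝ} (ht : t ∈ Ico t₀ T) (x : EuclideanSpace ℝ (Fin 3)) :
    (T - t) ^ (1 + 2 * C) * ‖u t x‖ ^ 3 ≤
      8 * (4 * Real.pi)⁻¹ * C * (T - t₀) ^ (2 * C) * ∫ y, ‖curl (u t₀) y‖ ^ 2 := by
  have hreg := hasBoundedSobolevNormsOn_before_of_lerayHopf_classical hν hT hmax.1 hLH hdec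
  have htT : t ∈ Ico 0 T := ⟨ht₀.trans ht.1, ht.2⟩
  have hTt : 0 < T - t := sub_pos.2 ht.2
  have hTt₀ : 0 < T - t₀ := sub_pos.2 ht₀T
  have hC0 : 0 ≤ C := le_trans (mul_nonneg hTt₀.le (norm_nonneg _)) (hω t₀ ⟨le_rfl, ht₀T⟩ 0)
  -- the slice: smooth, divergence free, finite energy and enstrophy
  set T'' : ℝ := (t + T) / 2 with hT''
  have hT''T : T'' < T := by rw [hT'']; linarith [ht.2]
  have hB : HasBoundedSobolevNormsOn (Icc 0 T'') u := hreg T'' hT''T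
  have htS : t ∈ Icc 0 T'' := ⟨htT.1, by rw [hT'']; linarith [ht.2]⟩
  have hvt := hmax.1.contDiff_velocity htT
  have hv2 : ∫⁻ y, ‖u t y‖ₑ ^ 2 < ⊤ := by
    obtain ⟨C0, hC0'⟩ := hB 0
    refine lt_of_le_of_lt (le_of_eq (lintegral_congr fun y => ?_)) ((hC0' t htS).trans_lt ENNReal.coe_lt_top)
    rw [← ofReal_norm, ← ofReal_norm, norm_iteratedFDeriv_zero]
  have hfin1 : ∫⁻ y, ‖iteratedFDeriv ℝ 1 (u t) y‖ₑ ^ 2 < ⊤ := by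
    obtain ⟨C1, hC1⟩ := hB 1
    exact (hC1 t htS).trans_lt ENNReal.coe_lt_top
  have hω2 : ∫⁻ y, ‖curl (u t) y‖ₑ ^ 2 < ⊤ :=
    lt_of_le_of_lt (lintegral_curl_sq_le (u t)) (ENNReal.mul_lt_top ENNReal.ofReal_lt_top hfin1)
  have hωc : Continuous (curl (u t)) := continuous_curl (hvt.of_le (by norm_cast))
  have hωI : Integrable fun y => ‖curl (u t) y‖ ^ 2 := integrable_sq_norm_of_lintegral_lt_top hωc hω2
  have hrep : biotSavart (curl (u t)) = u t :=
    biotSavart_curl_eq_self_of_lintegral_sq_lt_top (hvt.of_le (by norm_cast)) (hmax.1.divFree t htT) hv2 hω2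
  -- the vorticity bound `‖ω(t)‖ ≤ C/(T − t)`
  have hM : ∀ y, ‖curl (u t) y‖ ≤ C / (T - t) := fun y => by
    rw [le_div_iff₀ hTt, mul_comm]
    exact hω t ht y
  -- Biot–Savart interpolation, cubed
  set E : ℝ := ∫ y, ‖curl (u t) y‖ ^ 2 with hE
  have hE0 : 0 ≤ E := integral_nonneg fun y => sq_nonneg _
  have hbs := norm_biotSavart_le_rpow_third hωc.aestronglyMeasurable hM hωI x
  rw [hrep] at hbs
  have hM0 : 0 ≤ C / (T - t) := div_nonneg hC0 hTt.le
  have hpi : 0 < (4 * Real.pi)⁻¹ := by positivity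
  have hcube : ‖u t x‖ ^ 3 ≤ 8 * (4 * Real.pi)⁻¹ * (C / (T - t)) * E := by
    have h3 := pow_le_pow_left₀ (norm_nonneg _) hbs 3
    refine h3.trans (le_of_eq ?_)
    have hc : ∀ a : ℝ, 0 ≤ a → (a ^ (1 / 3 : ℝ)) ^ 3 = a := fun a ha => by
      rw [← Real.rpow_natCast, ← Real.rpow_mul ha]; norm_num
    calc (2 * ((4 * Real.pi)⁻¹) ^ (1 / 3 : ℝ) * (C / (T - t)) ^ (1 / 3 : ℝ) * E ^ (1 / 3 : ℝ)) ^ 3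
        = 8 * ((4 * Real.pi)⁻¹ ^ (1 / 3 : ℝ)) ^ 3 * ((C / (T - t)) ^ (1 / 3 : ℝ)) ^ 3 * (E ^ (1 / 3 : ℝ)) ^ 3 := by
          ring
      _ = 8 * (4 * Real.pi)⁻¹ * (C / (T - t)) * E := by rw [hc _ hpi.le, hc _ hM0, hc _ hE0]
  -- insert the power law and clear the powers of `T − t`
  have hEle : E ≤ (∫ y, ‖curl (u t₀) y‖ ^ 2) * ((T - t₀) / (T - t)) ^ (2 * C) :=
    integral_sq_norm_curl_le_rpow hν hmax.1 hreg ht₀ ht₀T hω ht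
  set E₀ : ℝ := ∫ y, ‖curl (u t₀) y‖ ^ 2 with hE₀
  have hE₀0 : 0 ≤ E₀ := integral_nonneg fun y => sq_nonneg _
  have hsplit : (T - t) ^ (1 + 2 * C) = (T - t) * (T - t) ^ (2 * C) := by
    rw [Real.rpow_add hTt, Real.rpow_one]
  have hdiv : ((T - t₀) / (T - t)) ^ (2 * C) = (T - t₀) ^ (2 * C) / (T - t) ^ (2 * C) :=
    Real.div_rpow hTt₀.le hTt.le _
  have hpow0 : 0 < (T - t) ^ (2 * C) := Real.rpow_pos_of_pos hTt _
  calc (T - t) ^ (1 + 2 * C) * ‖u t x‖ ^ 3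
      ≤ (T - t) ^ (1 + 2 * C) * (8 * (4 * Real.pi)⁻¹ * (C / (T - t)) * E) :=
        mul_le_mul_of_nonneg_left hcube (Real.rpow_nonneg hTt.le _)
    _ ≤ (T - t) ^ (1 + 2 * C) * (8 * (4 * Real.pi)⁻¹ * (C / (T - t)) * (E₀ * ((T - t₀) / (T - t)) ^ (2 * C))) := by
        gcongr
    _ = 8 * (4 * Real.pi)⁻¹ * C * (T - t₀) ^ (2 * C) * E₀ := by
        rw [hsplit, hdiv]
        field_simp

/-! ### The modulation law is pinned by the certificate constant -/

/-- **The dimensionless vertex distance at a gauge time.** If moreover `tₖ ∈ [t₀, T)`, `λₖ > 0`, and at some point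
`(λₖ/ν)‖u(tₖ, xₖ)‖ ≥ 1/2` (a near-maximum of the gauge), then `dₖ = ν(T − tₖ)/λₖ²` satisfies
`dₖ³ ≤ (64/ν³) · (8(4π)⁻¹ C (T − t₀)^{2C} ∫|ω(t₀)|²)² · (T − tₖ)^{1 − 4C}` (`dₖ ≤ 4(T − tₖ)‖u(tₖ, xₖ)‖²/ν` and the
velocity bound squared). [new here — elementary] -/
theorem gauge_vertex_distance_cube_le (hν : 0 < ν) (hT : 0 < T) (hmax : IsMaximalSmoothSolution ν 0 u p T)
    (hLH : IsLerayHopfOn T ν 0 (u 0) u) (hdec : HasRapidSpatialDecay (u 0))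
    {C t₀ : ℝ} (ht₀ : 0 ≤ t₀) (ht₀T : t₀ < T) (hω : ∀ t ∈ Ico t₀ T, ∀ x, (T - t) * ‖curl (u t) x‖ ≤ C)
    {tk lam : ℝ} (htk : tk ∈ Ico t₀ T) (hlam : 0 < lam) {xk : EuclideanSpace ℝ (Fin 3)}
    (hnear : 1 / 2 ≤ lam / ν * ‖u tk xk‖) :
    (ν * (T - tk) / lam ^ 2) ^ 3 ≤
      64 / ν ^ 3 * (8 * (4 * Real.pi)⁻¹ * C * (T - t₀) ^ (2 * C) * ∫ y, ‖curl (u t₀) y‖ ^ 2) ^ 2 *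
        (T - tk) ^ (1 - 4 * C) := by
  set K : ℝ := 8 * (4 * Real.pi)⁻¹ * C * (T - t₀) ^ (2 * C) * ∫ y, ‖curl (u t₀) y‖ ^ 2 with hK
  have hTt : 0 < T - tk := sub_pos.2 htk.2
  have hcube := cube_norm_le_of_vorticityRate hν hT hmax hLH hdec ht₀ ht₀T hω htk xk
  rw [← hK] at hcube
  set U : ℝ := ‖u tk xk‖ with hU
  have hU0 : 0 ≤ U := norm_nonneg _
  -- `ν/λ ≤ 2U`, hence `d ≤ 4(T − tₖ)U²/ν`
  have hνlam : ν / lam ≤ 2 * U := by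
    rw [div_le_iff₀ hlam]
    have h := hnear
    rw [div_mul_eq_mul_div, le_div_iff₀ hν] at h
    linarith
  have hd' : ν * (T - tk) / lam ^ 2 ≤ 4 * (T - tk) * U ^ 2 / ν := by
    have h1 : ν * (T - tk) / lam ^ 2 = (T - tk) * (ν / lam) ^ 2 / ν := by
      field_simp
    rw [h1]
    refine div_le_div_of_nonneg_right ?_ hν.le
    have h2 : (ν / lam) ^ 2 ≤ (2 * U) ^ 2 := pow_le_pow_left₀ (div_nonneg hν.le hlam.le) hνlam 2
    nlinarith [h2, hTt.le]
  have hd0 : 0 ≤ ν * (T - tk) / lam ^ 2 := by positivity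
  -- cube: `d³ ≤ 64 (T − tₖ)³ U⁶ / ν³` and `(T − tₖ)^{2+4C} U⁶ ≤ K²`
  have hU6 : ((T - tk) ^ (1 + 2 * C)) ^ 2 * U ^ 6 ≤ K ^ 2 := by
    have h := pow_le_pow_left₀ (by positivity) hcube 2
    calc ((T - tk) ^ (1 + 2 * C)) ^ 2 * U ^ 6 = ((T - tk) ^ (1 + 2 * C) * U ^ 3) ^ 2 := by ring
      _ ≤ K ^ 2 := h
  have hsplit : ((T - tk) ^ (1 + 2 * C)) ^ 2 * (T - tk) ^ (1 - 4 * C) = (T - tk) ^ (3 : ℕ) := by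
    rw [← Real.rpow_natCast ((T - tk) ^ (1 + 2 * C)) 2, ← Real.rpow_mul hTt.le, ← Real.rpow_add hTt,
      ← Real.rpow_natCast (T - tk) 3]
    congr 1
    push_cast
    ring
  calc (ν * (T - tk) / lam ^ 2) ^ 3 ≤ (4 * (T - tk) * U ^ 2 / ν) ^ 3 := pow_le_pow_left₀ hd0 hd' 3
    _ = 64 / ν ^ 3 * ((T - tk) ^ (3 : ℕ) * U ^ 6) := by ring
    _ = 64 / ν ^ 3 * ((((T - tk) ^ (1 + 2 * C)) ^ 2 * U ^ 6) * (T - tk) ^ (1 - 4 * C)) := by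
        rw [← hsplit]; ring
    _ ≤ 64 / ν ^ 3 * (K ^ 2 * (T - tk) ^ (1 - 4 * C)) := by
        gcongr
    _ = 64 / ν ^ 3 * K ^ 2 * (T - tk) ^ (1 - 4 * C) := by ring

/-! ### Assembled for the witnesses of the certificate class -/

/-- **`C > 1/4` STRICTLY for every witness of the certificate class.** Deposit 6 gives `C ≥ 1/4`. If `C = 1/4`, the exponent
`1 − 4C` vanishes and `gauge_vertex_distance_cube_le` bounds `dₖ³` uniformly along ANY gauge sequence with near-max points;
but deposit 7 (`vorticityRate_witness_typeII_gauge_uniformStream`, KNSS) provides a gauge sequence with `dₖ → ∞`.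
[cite: KochNadirashviliSereginSverak2009, Thms 6.1–6.2] -/
theorem vorticityRate_witness_const_gt_quarter (hν : 0 < ν) (hT : 0 < T)
    (hmax : IsMaximalSmoothSolution ν 0 u p T) (hLH : IsLerayHopfOn T ν 0 (u 0) u)
    (hdec : HasRapidSpatialDecay (u 0)) (haxi : IsAxisymmetric (u 0)) {C : ℝ}
    (hrate : ∀ᶠ t in 𝓝[<] T, ∀ x : EuclideanSpace ℝ (Fin 3), (T - t) * ‖curl (u t) x‖ ≤ C) : 1 / 4 < C := by
  have hge := vorticityRate_witness_const_ge_quarter hν hT hmax hLH hdec haxi hrate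
  rcases lt_or_eq_of_le hge with hlt | heq
  · exact hlt
  exfalso
  -- the rate on an interval `[t₀, T)`
  obtain ⟨l, hlT, hl⟩ := mem_nhdsLT_iff_exists_Ioo_subset.1 hrate
  have hlT' : l < T := hlT
  set t₀ : ℝ := max 0 ((l + T) / 2) with ht₀
  have ht₀0 : 0 ≤ t₀ := le_max_left _ _
  have ht₀T : t₀ < T := max_lt hT (by linarith)
  have hlt₀ : l < t₀ := lt_of_lt_of_le (by linarith) (le_max_right _ _)
  have hω : ∀ t ∈ Ico t₀ T, ∀ x, (T - t) * ‖curl (u t) x‖ ≤ C := fun t ht =>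
    hl ⟨lt_of_lt_of_le hlt₀ ht.1, ht.2⟩
  -- the Type-II gauge sequence of deposit 7
  obtain ⟨tn, lamn, cn, xn, φ, W, htn, htT, hlam, -, -, hnear, -, -, -, -, -, hII, -⟩ :=
    vorticityRate_witness_typeII_gauge_uniformStream hν hT hmax hLH hdec haxi ⟨C, hrate⟩
  set K : ℝ := 8 * (4 * Real.pi)⁻¹ * C * (T - t₀) ^ (2 * C) * ∫ y, ‖curl (u t₀) y‖ ^ 2 with hK
  have hev1 : ∀ᶠ k in atTop, t₀ ≤ tn k := htT.eventually (eventually_ge_nhds ht₀T)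
  have hev2 : ∀ᶠ k in atTop, 1 / 2 ≤ lamn k / ν * ‖u (tn k) (xn k)‖ :=
    hnear.eventually (eventually_ge_nhds (by norm_num : (1 : ℝ) / 2 < 1))
  have hbig : ∀ᶠ k in atTop, 64 / ν ^ 3 * K ^ 2 + 1 ≤ ν * (T - tn k) / lamn k ^ 2 := hII.eventually (eventually_ge_atTop _)
  obtain ⟨k, hk1, hk2, hk3⟩ := (hev1.and (hev2.and hbig)).exists
  have hd := gauge_vertex_distance_cube_le hν hT hmax hLH hdec ht₀0 ht₀T hω ⟨hk1, (htn k).2⟩ (hlam k) hk2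
  rw [← hK, ← heq, show (1 : ℝ) - 4 * (1 / 4) = 0 by norm_num, Real.rpow_zero, mul_one] at hd
  -- `d ≥ 1` and `d³ ≤ M` with `d ≥ M + 1`: contradiction
  set d : ℝ := ν * (T - tn k) / lamn k ^ 2 with hdd
  have hM0 : 0 ≤ 64 / ν ^ 3 * K ^ 2 := by positivity
  have hd1 : 1 ≤ d := by linarith
  have hd3 : d ≤ d ^ 3 := by
    calc d = d * 1 * 1 := by ring
      _ ≤ d * d * d := by gcongr
      _ = d ^ 3 := by ring
  linarith

/-- **CERTIFICATE-CLASS WITNESSES: THE VELOCITY RATE EXPONENT IS AT MOST `(1 + 2C)/3`.** For every `(ν, T, u, p)` of the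
certificate class and every `C` with `(T − t)‖curl u(t, x)‖ ≤ C` near `T⁻`: there are `t₀ ∈ [0, T)` and `K ≥ 0` with
`(T − t)^{1+2C}‖u(t, x)‖³ ≤ K` for all `t ∈ [t₀, T)` and all `x` (and `C > 1/4`). [cite: MajdaBertozziCUP2002, §4.1.3 (4.30)] -/
theorem vorticityRate_witness_velocity_exponent (hν : 0 < ν) (hT : 0 < T)
    (hmax : IsMaximalSmoothSolution ν 0 u p T) (hLH : IsLerayHopfOn T ν 0 (u 0) u)
    (hdec : HasRapidSpatialDecay (u 0)) (haxi : IsAxisymmetric (u 0)) {C : ℝ}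
    (hrate : ∀ᶠ t in 𝓝[<] T, ∀ x : EuclideanSpace ℝ (Fin 3), (T - t) * ‖curl (u t) x‖ ≤ C) :
    1 / 4 < C ∧ ∃ t₀ ∈ Ico 0 T, ∃ K : ℝ, 0 ≤ K ∧
      ∀ t ∈ Ico t₀ T, ∀ x : EuclideanSpace ℝ (Fin 3), (T - t) ^ (1 + 2 * C) * ‖u t x‖ ^ 3 ≤ K := by
  refine ⟨vorticityRate_witness_const_gt_quarter hν hT hmax hLH hdec haxi hrate, ?_⟩
  obtain ⟨l, hlT, hl⟩ := mem_nhdsLT_iff_exists_Ioo_subset.1 hrate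
  have hlT' : l < T := hlT
  set t₀ : ℝ := max 0 ((l + T) / 2) with ht₀
  have ht₀0 : 0 ≤ t₀ := le_max_left _ _
  have ht₀T : t₀ < T := max_lt hT (by linarith)
  have hlt₀ : l < t₀ := lt_of_lt_of_le (by linarith) (le_max_right _ _)
  have hω : ∀ t ∈ Ico t₀ T, ∀ x, (T - t) * ‖curl (u t) x‖ ≤ C := fun t ht =>
    hl ⟨lt_of_lt_of_le hlt₀ ht.1, ht.2⟩
  have hC0 : 0 ≤ C := le_trans (mul_nonneg (sub_pos.2 ht₀T).le (norm_nonneg _)) (hω t₀ ⟨le_rfl, ht₀T⟩ 0)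
  have hE₀0 : 0 ≤ ∫ y, ‖curl (u t₀) y‖ ^ 2 := integral_nonneg fun y => sq_nonneg _
  refine ⟨t₀, ⟨ht₀0, ht₀T⟩, 8 * (4 * Real.pi)⁻¹ * C * (T - t₀) ^ (2 * C) * ∫ y, ‖curl (u t₀) y‖ ^ 2,
    mul_nonneg (mul_nonneg (by positivity) (Real.rpow_nonneg (sub_pos.2 ht₀T).le _)) hE₀0, fun t ht x => ?_⟩
  exact cube_norm_le_of_vorticityRate hν hT hmax hLH hdec ht₀0 ht₀T hω ht x

end Summit.NavierStokesRegularity.NavierStokesRegularity.Theorems.CertifiedBlowupVorticityRateBlowup.ConstantFloor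

end
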